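/-
Origin: expansion seat `prover-pub-hodgecm-mc-sinst-1-g9-0`, handover #1244 2026-08-20T21:44Z md5 b09ff2bc6b6e (185 l.; NEW additive leaf, ns HodgeCM.Model.ThetaAdelicSide; imports #1243 + #S14; certified privately rc 0 / 15 s, 0 warn / 0 proof-hole against RUN-63 PKG oleans + #1240–#1243 oleans + #S14 built locally from theta-3's staged r1 753d256a7fea (and again against their RUN-65 r2 e18e6ecac7ea: rc 0), `#print axioms` 6/6 ⊆ {propext, Classical.choice, Quot.sound} (out/logs/AxBlock.log), 0 records / 0 `def … : Prop`, FQN grep vs PKG 0; §Generic `of_smul_clsU_comp`, **`clsU_mem_iSup_range_of_equivariant`** (any ρ : Representation ℂ ↥V.adelicFin Ω, any θb : Ω →ₗ[ℂ] holSatU with θb (ρ g x) = holSatRep g (θb x) ⇒ clsU (θb x) ∈ ⨆ ψ : ρ.asModule →ₗ[MonoidAlgebra ℂ ↥V.adelicFin] Tower, (range ψ).restrictScalars ℂ), `map_clsU_range_le_iSup_range`; §Weil (general JV : Matrix (Fin 3) (Fin 3) L, pullback hom ιV : ↥V.adelicFin →* ↥(UnitaryGroup.finAdelic L⁺ L c̄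 3 JV), O5 data M e JW hcδ hδ hd hVs hW hVd hWd hJV hJW χ hs): **`weilCoinvLift_equivariant`** (weilCoinvLift χ hs f hf ((weilCoinv … χ hs).comp ιV g x) = holSatRep g (weilCoinvLift … x) from hσ : ∀ g φ, f (finPairRep hs (ιV g, 1) φ) = holSatRep g (f φ)), **`clsU_mem_iSup_range_weilCoinv`** (clsU (f φ) ∈ ⨆ ψ : Representation.asModule ((weilCoinv … χ hs).comp ιV) →ₗ[MonoidAlgebra ℂ ↥V.adelicFin] Tower, (range ψ).restrictScalars ℂ = the dictionary's oscImage ⟨p,χ⟩ ≤ block p of axioms-1 #4 when ιV = id, JV = V.Hm, M = 1), `map_clsU_range_le_iSup_range_weilCoinv`; NAMES for audit: `HodgeCM.Model.ThetaAdelicSide.clsU_mem_iSup_range_of_equivariant` · `HodgeCM.Model.ThetaAdelicSide.weilCoinvLift_equivariant` · `HodgeCM.Model.ThetaAdelicSide.clsU_mem_iSup_range_weilCoinv`) (`HOME/mc/pub-hodgecm-mc-sinst-1-g9/stage64/HodgeCM/Model/AdelicThetaTowerBlock.lean`, md5 b09ff2bc6b6e, 185 lines);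
landed by the second packager p2 gen 14 (p2-g14) in gate run 64 as `HodgeCM/Model/AdelicThetaTowerBlock.lean` (verbatim).
-/
/-
Copyright (c) 2026 the pub-hodgecm formalisation cell (harness21).  New file, not vendored.
Origin: session prover-pub-hodgecm-mc-sinst-1-g9-0 (unit pub-hodgecm-mc-sinst-1-g9, S-INSTANCE CONSTRUCTOR gen 9; the (J2)↔(J4) seam of the
(J-Liu-Θ) junction behind E's row 9 `hΘ`: the block-membership glue between the tower class map (#1243) and theta-3's O5 Weil
coinvariants `Ω(s, χ)`), 2026-08-20.
Intended final place: `HodgeCM/Model/AdelicThetaTowerBlock.lean` (NEW additive model-layer leaf; imports sinst-1's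
`HodgeCM.Model.AdelicThetaTowerLift` (#1243) and theta-3's `HodgeCM.Model.WeilCentralCoinvariants` (#S14); nothing imports it; drop alone).
-/
import Summits.HodgeConjecture.HodgeCM.Model.AdelicThetaTowerLift
import Summits.HodgeConjecture.HodgeCM.Model.WeilCentralCoinvariants_3

-- G11b-3 recipe (port D30 slow-export class; ops-buildfix LEDGER B13-1/B13-3): elaborate sequentially so the trailing
-- `attribute [implicit_reducible]` block (reducibilityCoreExt is keyed to the async environment branch) is in force at `.olean` export.
set_option Elab.async false

set_option autoImplicit false

/-!
# Tower classes of an equivariant theta distribution lie in the block of its source module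

Two kernel statements closing the SHAPE of the second clause of binder-1's `hfam` (#R115 `subset_span_of_tower`) on the theta side:

* `clsU_mem_iSup_range_of_equivariant` — for ANY representation `ρ` of `U(V)(𝔸_f)` on a `ℂ`-module `Ω` and any `ℂ`-linear
  `θb : Ω → S.holSatU hV k 𝓕` intertwining `ρ` with `S.holSatRep hV k 𝓕` (right translation), every tower class `clsU (θb x)` lies in
  `⨆ ψ : ρ.asModule →ₗ[ℂ[U(V)(𝔸_f)]] Tower … V, range ψ` — the `oscImage`/`block` shape of the (J3) dictionary at the module `Ω`
  (#1237 `EquivariantLift.mem_iSup_range_of_equivariant` applied to the intertwiner `clsU ∘ θb`, #1243 `of_smul_clsU`);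
* `clsU_mem_iSup_range_weilCoinv` — the same at theta-3's O5 module **`Ω(s, χ) = WeilCoinv.weilCoinv … χ hs`** (the `χ`-coinvariants of
  the finite Weil representation of the pair under the `U(W)`-member, [Liu21, (4.2)]) pulled back along any hom
  `ιV : U(V)(𝔸_f) → U(J_V)(𝔸_{L⁺,f})` (identity for `J_V := V.Hm`; carch's `finFrameCongr` for the framed diagonal datum of the honest
  Weil term, theta-3 STATUS 2026-08-20 21:42Z): a `ℂ`-linear `f : 𝒮((𝔸_{L⁺}^∞)^{3M}) → S.holSatU hV k 𝓕` with the `U(W)`-`χ`-variance `hf`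
  and the `U(V)`-equivariance `hσ` against `holSatRep` along `ιV` (the two properties of the theta distribution `Φ_f ↦ θ(φ_∞ ⊗ Φ_f, ·)`)
  factors through `Ω(s, χ)` (`WeilCoinv.weilCoinvLift`) equivariantly, so every class `clsU (f Φ_f)` lies in
  `⨆ ψ : (ιV^*Ω(s,χ)).asModule →ₗ[ℂ[U(V)(𝔸_f)]] Tower … V, range ψ`.
What these do NOT supply: the distribution `f` itself with `hf`/`hσ` (the arch ⊗ fin factorisation of the honest Weil term — theta-3's
custody) and the hol-germ property of general theta forms ((J4-hol)).
KERNEL only: 0 records, 0 `def … : Prop`, nothing cited as a sentence; `#print axioms` ⊆ {propext, Classical.choice, Quot.sound}.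
-/

noncomputable section

open MulAction NumberField
open Literature.NumberTheory.Automorphic Literature.NumberTheory.Weil1964
open Literature.NumberTheory.GelbartRogawski1991 Literature.NumberTheory.GelbartRogawski1991.UnitaryDualPair
open Literature.Geometry.ComplexHyperbolic.BallModel (U21 x₀)
open Literature.AlgebraicGeometry.HodgeTheory Literature.AlgebraicGeometry.ShimuraVarieties
open Literature.NumberTheory.Automorphic.PicardCM
open Literature.NumberTheory.Transcendental (Arapura2012_Cor_15_4_6)
open HodgeCM.Model.SupplyResidual HodgeCM.Model.ThetaSpace HodgeCM.Model.LevelTranslate HodgeCM.Model.TowerLevel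
open HodgeCM.Model.TowerCarrier

namespace HodgeCM
namespace Model
namespace ThetaAdelicSide

variable (hHD : exists_isReal_hodgeModel) (hI : hodgePQ_independent_of_hodgeModel)
  (h₁ : BallQuotientUniformised) (h₃ : CMAbelianVarietyRealised) (hA : Arapura2012_Cor_15_4_6)
variable {L : CMField} {ι₁ : L →+* ℂ} {V : HermSpace3 L ι₁} {c : SeesawCtx L} (S : ThetaAdelicSide V c)
variable {𝓕 : Set C(NumberField.relNormOneIdeles (↥(maximalRealSubfield L)) L ⧸
    NumberField.relNormOneRat (↥(maximalRealSubfield L)) L, ℂ)}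

section Generic

variable {Ω : Type*} [AddCommGroup Ω] [Module ℂ Ω]

/-- **An intertwiner into the hol-germ theta module, composed with the tower class map, is an intertwiner into the tower**
(`ℂ[G]`-module form): `of g • clsU (θb x) = clsU (θb (ρ g x))`. -/
theorem of_smul_clsU_comp (hι : S.ιinf = archInfOf V) (hV : IsAnisotropic L V.Hm) (k : Fin 4)
    (ρ : Representation ℂ ↥V.adelicFin Ω) (θb : Ω →ₗ[ℂ] S.holSatU hV k 𝓕)
    (hθ : ∀ (g : V.adelicFin) (x : Ω), θb (ρ g x) = S.holSatRep hV k 𝓕 g (θb x)) (g : V.adelicFin) (x : Ω) :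
    (S.clsU hHD hI h₁ h₃ hA 𝓕 hι hV k ∘ₗ θb) (ρ g x) =
      MonoidAlgebra.of ℂ ↥V.adelicFin g • (S.clsU hHD hI h₁ h₃ hA 𝓕 hι hV k ∘ₗ θb) x := by
  rw [LinearMap.comp_apply, LinearMap.comp_apply, hθ, S.of_smul_clsU hHD hI h₁ h₃ hA hι hV k g]

/-- **Block membership, generic module**: for any representation `ρ` of `U(V)(𝔸_f)` on `Ω` and any `ℂ`-linear `θb : Ω → holSatU`
intertwining `ρ` with right translation, every tower class `clsU (θb x)` lies in `⨆ ψ : ρ.asModule →ₗ[ℂ[U(V)(𝔸_f)]] Tower, range ψ`. -/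
theorem clsU_mem_iSup_range_of_equivariant (hι : S.ιinf = archInfOf V) (hV : IsAnisotropic L V.Hm) (k : Fin 4)
    (ρ : Representation ℂ ↥V.adelicFin Ω) (θb : Ω →ₗ[ℂ] S.holSatU hV k 𝓕)
    (hθ : ∀ (g : V.adelicFin) (x : Ω), θb (ρ g x) = S.holSatRep hV k 𝓕 g (θb x)) (x : Ω) :
    S.clsU hHD hI h₁ h₃ hA 𝓕 hι hV k (θb x) ∈
      ⨆ ψ : ρ.asModule →ₗ[MonoidAlgebra ℂ ↥V.adelicFin] Tower hHD hI (ballQuotientUniformisedDatum_of h₁) h₃ hA V,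
        (LinearMap.range ψ).restrictScalars ℂ :=
  EquivariantLift.mem_iSup_range_of_equivariant ρ (S.clsU hHD hI h₁ h₃ hA 𝓕 hι hV k ∘ₗ θb)
    (fun g x => S.of_smul_clsU_comp hHD hI h₁ h₃ hA hι hV k ρ θb hθ g x) x

/-- The same for the WHOLE range: `clsU '' (range θb) ⊆ ⨆ ψ, range ψ`, as an inequality of submodules. -/
theorem map_clsU_range_le_iSup_range (hι : S.ιinf = archInfOf V) (hV : IsAnisotropic L V.Hm) (k : Fin 4)
    (ρ : Representation ℂ ↥V.adelicFin Ω) (θb : Ω →ₗ[ℂ] S.holSatU hV k 𝓕)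
    (hθ : ∀ (g : V.adelicFin) (x : Ω), θb (ρ g x) = S.holSatRep hV k 𝓕 g (θb x)) :
    (LinearMap.range θb).map (S.clsU hHD hI h₁ h₃ hA 𝓕 hι hV k) ≤
      ⨆ ψ : ρ.asModule →ₗ[MonoidAlgebra ℂ ↥V.adelicFin] Tower hHD hI (ballQuotientUniformisedDatum_of h₁) h₃ hA V,
        (LinearMap.range ψ).restrictScalars ℂ := by
  rintro _ ⟨_, ⟨x, rfl⟩, rfl⟩
  exact S.clsU_mem_iSup_range_of_equivariant hHD hI h₁ h₃ hA hι hV k ρ θb hθ x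

end Generic

section Weil

/-! ### At theta-3's O5 module `Ω(s, χ)` pulled back along a hom `ιV : U(V)(𝔸_f) → U(J_V)(𝔸_{L⁺,f})`
(cell data `(L⁺, L, c̄, 3, J_V)`; `ιV := MonoidHom.id _` for `J_V := V.Hm` — `↥(UnitaryGroup.finAdelic … 3 V.Hm) = ↥V.adelicFin` by `rfl` —
and `ιV :=` carch's frame transport `finFrameCongr` for the FRAMED diagonal datum `J_V := diagonal (frameD V)` of the honest Weil term) -/

variable (M : ℕ) {n : ℕ} (e : Fin 3 × Fin M ≃ Fin n) (JV : Matrix (Fin 3) (Fin 3) L) (JW : Matrix (Fin M) (Fin M) L)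
variable {TV : Matrix (Fin 3) (Fin 3) ↥(maximalRealSubfield L)} {TW : Matrix (Fin M) (Fin M) ↥(maximalRealSubfield L)}
variable [Algebra.IsQuadraticExtension (↥(maximalRealSubfield L)) L] {δ : L}
  (hcδ : IsCMField.complexConj L δ = -δ) (hδ : δ ≠ 0) {d : ↥(maximalRealSubfield L)}
  (hd : δ * δ = algebraMap (↥(maximalRealSubfield L)) L d) (hVs : TV.IsSymm) (hW : TW.IsSymm) (hVd : IsUnit TV.det)
  (hWd : IsUnit TW.det) (hJV : JV = TV.map (algebraMap (↥(maximalRealSubfield L)) L))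
  (hJW : JW = TW.map (algebraMap (↥(maximalRealSubfield L)) L))
  {s : UnitaryGroup.adelicPair (↥(maximalRealSubfield L)) L (IsCMField.complexConj L) 3 M JV JW →*
    adelicMpCont (↥(maximalRealSubfield L)) (Fin n) (adelicGram (↥(maximalRealSubfield L)) e TV TW)}
  (χ : UnitaryGroup.finAdelic (↥(maximalRealSubfield L)) L (IsCMField.complexConj L) M JW →* ℂˣ)
  (hs : (splittingDatum (↥(maximalRealSubfield L)) L (IsCMField.complexConj L) 3 M e JV JW hcδ hδ hd hVs hW hVd hWd
    hJV hJW).IsCompatible s)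
  (ιV : ↥V.adelicFin →* ↥(UnitaryGroup.finAdelic (↥(maximalRealSubfield L)) L (IsCMField.complexConj L) 3 JV))

/-- **The factored theta distribution is an intertwiner `ιV^*Ω(s, χ) → holSatU`** (theta-3's `weilCoinvLift_weilCoinv` shape, along `ιV`). -/
theorem weilCoinvLift_equivariant (hV : IsAnisotropic L V.Hm) (k : Fin 4)
    (f : FinSB (↥(maximalRealSubfield L)) (Fin 3 × Fin M) →ₗ[ℂ] S.holSatU hV k 𝓕)
    (hf : ∀ (u : UnitaryGroup.finAdelic (↥(maximalRealSubfield L)) L (IsCMField.complexConj L) M JW)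
        (φ : FinSB (↥(maximalRealSubfield L)) (Fin 3 × Fin M)),
      f (WeilCoinv.finPairRep (↥(maximalRealSubfield L)) L (IsCMField.complexConj L) 3 M e JV JW hcδ hδ hd hVs hW hVd hWd
        hJV hJW hs (1, u) φ) = ((χ u : ℂˣ) : ℂ) • f φ)
    (hσ : ∀ (g : V.adelicFin) (φ : FinSB (↥(maximalRealSubfield L)) (Fin 3 × Fin M)),
      f (WeilCoinv.finPairRep (↥(maximalRealSubfield L)) L (IsCMField.complexConj L) 3 M e JV JW hcδ hδ hd hVs hW hVd hWd
        hJV hJW hs (ιV g, 1) φ) = S.holSatRep hV k 𝓕 g (f φ))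
    (g : V.adelicFin)
    (x : TwistedCoinv.Coinv (WeilCoinv.finPairRepW (↥(maximalRealSubfield L)) L (IsCMField.complexConj L) 3 M e JV JW hcδ
      hδ hd hVs hW hVd hWd hJV hJW hs) χ) :
    WeilCoinv.weilCoinvLift (↥(maximalRealSubfield L)) L (IsCMField.complexConj L) 3 M e JV JW hcδ hδ hd hVs hW hVd hWd hJV
        hJW χ hs f hf
        ((WeilCoinv.weilCoinv (↥(maximalRealSubfield L)) L (IsCMField.complexConj L) 3 M e JV JW hcδ hδ hd hVs hW hVd hWd hJV
          hJW χ hs).comp ιV g x) =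
      S.holSatRep hV k 𝓕 g
        (WeilCoinv.weilCoinvLift (↥(maximalRealSubfield L)) L (IsCMField.complexConj L) 3 M e JV JW hcδ hδ hd hVs hW hVd hWd
          hJV hJW χ hs f hf x) := by
  obtain ⟨φ, rfl⟩ := TwistedCoinv.mk_surjective _ χ x
  rw [MonoidHom.comp_apply, WeilCoinv.weilCoinv_mk, WeilCoinv.weilCoinvLift_mk, WeilCoinv.weilCoinvLift_mk]
  exact hσ g φ

/-- **Block membership at `Ω(s, χ)`**: for a `ℂ`-linear `f : 𝒮((𝔸_{L⁺}^∞)^{3M}) → holSatU` with the `U(W)`-`χ`-variance `hf` and the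
`U(V)(𝔸_f)`-equivariance `hσ` (the theta distribution's two properties), every tower class `clsU (f Φ_f)` lies in
`⨆ ψ : (ιV^*Ω(s,χ)).asModule →ₗ[ℂ[U(V)(𝔸_f)]] Tower … V, range ψ` — the `block` of the (J3) dictionary at the module `ιV^*Ω(s, χ)`. -/
theorem clsU_mem_iSup_range_weilCoinv (hι : S.ιinf = archInfOf V) (hV : IsAnisotropic L V.Hm) (k : Fin 4)
    (f : FinSB (↥(maximalRealSubfield L)) (Fin 3 × Fin M) →ₗ[ℂ] S.holSatU hV k 𝓕)
    (hf : ∀ (u : UnitaryGroup.finAdelic (↥(maximalRealSubfield L)) L (IsCMField.complexConj L) M JW)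
        (φ : FinSB (↥(maximalRealSubfield L)) (Fin 3 × Fin M)),
      f (WeilCoinv.finPairRep (↥(maximalRealSubfield L)) L (IsCMField.complexConj L) 3 M e JV JW hcδ hδ hd hVs hW hVd hWd
        hJV hJW hs (1, u) φ) = ((χ u : ℂˣ) : ℂ) • f φ)
    (hσ : ∀ (g : V.adelicFin) (φ : FinSB (↥(maximalRealSubfield L)) (Fin 3 × Fin M)),
      f (WeilCoinv.finPairRep (↥(maximalRealSubfield L)) L (IsCMField.complexConj L) 3 M e JV JW hcδ hδ hd hVs hW hVd hWd
        hJV hJW hs (ιV g, 1) φ) = S.holSatRep hV k 𝓕 g (f φ))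
    (φ : FinSB (↥(maximalRealSubfield L)) (Fin 3 × Fin M)) :
    S.clsU hHD hI h₁ h₃ hA 𝓕 hι hV k (f φ) ∈
      ⨆ ψ : Representation.asModule ((WeilCoinv.weilCoinv (↥(maximalRealSubfield L)) L (IsCMField.complexConj L) 3 M e JV JW hcδ
          hδ hd hVs hW hVd hWd hJV hJW χ hs).comp ιV) →ₗ[MonoidAlgebra ℂ ↥V.adelicFin]
            Tower hHD hI (ballQuotientUniformisedDatum_of h₁) h₃ hA V,
        (LinearMap.range ψ).restrictScalars ℂ :=
  S.clsU_mem_iSup_range_of_equivariant hHD hI h₁ h₃ hA hι hV k _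
    (WeilCoinv.weilCoinvLift (↥(maximalRealSubfield L)) L (IsCMField.complexConj L) 3 M e JV JW hcδ hδ hd hVs hW hVd hWd hJV
      hJW χ hs f hf)
    (S.weilCoinvLift_equivariant M e JV JW hcδ hδ hd hVs hW hVd hWd hJV hJW χ hs ιV hV k f hf hσ)
    (TwistedCoinv.mk _ χ φ)

/-- The same for the whole range of `f`: `clsU '' (range f) ⊆ block(Ω(s, χ))`. -/
theorem map_clsU_range_le_iSup_range_weilCoinv (hι : S.ιinf = archInfOf V) (hV : IsAnisotropic L V.Hm) (k : Fin 4)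
    (f : FinSB (↥(maximalRealSubfield L)) (Fin 3 × Fin M) →ₗ[ℂ] S.holSatU hV k 𝓕)
    (hf : ∀ (u : UnitaryGroup.finAdelic (↥(maximalRealSubfield L)) L (IsCMField.complexConj L) M JW)
        (φ : FinSB (↥(maximalRealSubfield L)) (Fin 3 × Fin M)),
      f (WeilCoinv.finPairRep (↥(maximalRealSubfield L)) L (IsCMField.complexConj L) 3 M e JV JW hcδ hδ hd hVs hW hVd hWd
        hJV hJW hs (1, u) φ) = ((χ u : ℂˣ) : ℂ) • f φ)
    (hσ : ∀ (g : V.adelicFin) (φ : FinSB (↥(maximalRealSubfield L)) (Fin 3 × Fin M)),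
      f (WeilCoinv.finPairRep (↥(maximalRealSubfield L)) L (IsCMField.complexConj L) 3 M e JV JW hcδ hδ hd hVs hW hVd hWd
        hJV hJW hs (ιV g, 1) φ) = S.holSatRep hV k 𝓕 g (f φ)) :
    (LinearMap.range f).map (S.clsU hHD hI h₁ h₃ hA 𝓕 hι hV k) ≤
      ⨆ ψ : Representation.asModule ((WeilCoinv.weilCoinv (↥(maximalRealSubfield L)) L (IsCMField.complexConj L) 3 M e JV JW hcδ
          hδ hd hVs hW hVd hWd hJV hJW χ hs).comp ιV) →ₗ[MonoidAlgebra ℂ ↥V.adelicFin]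
            Tower hHD hI (ballQuotientUniformisedDatum_of h₁) h₃ hA V,
        (LinearMap.range ψ).restrictScalars ℂ := by
  rintro _ ⟨_, ⟨φ, rfl⟩, rfl⟩
  exact S.clsU_mem_iSup_range_weilCoinv hHD hI h₁ h₃ hA M e JV JW hcδ hδ hd hVs hW hVd hWd hJV hJW χ hs ιV hι hV k f hf hσ φ

end Weil


end ThetaAdelicSide
end Model
end HodgeCM

end
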